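import Summits.RiemannHypothesis.RiemannHypothesis.Theorems.SignConeExactConeRigidityToeplitz
import Mathlib.MeasureTheory.Integral.DominatedConvergence
import Mathlib.MeasureTheory.Integral.ExpDecay
import Mathlib.MeasureTheory.Function.Floor
import Mathlib.Analysis.SpecialFunctions.Exponential
import Mathlib.MeasureTheory.Measure.Lebesgue.Basic

/-!
# Route SignCone, item `ExactConeRigidity` (stmt-RiemannHypothesis-16306): the Laplace transform of a
bounded continuous positive-definite function has nonnegative real part

Abstract analysis for the CARATHÉODORY DESCRIPTION of cone weights (archive 2001 fefr Thm A). A function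
`a : ℝ → ℂ` is positive-definite in the elementary sense if `0 ≤ Re Σ_{j,k} z_j conj(z_k) a(x_j - x_k)` for all
finite families; if moreover `a(-x) = conj a(x)`, `a` is continuous and bounded, then

  `0 ≤ Re ∫₀^∞ a(x) e^{-zx} dx`  for every `Re z > 0`  (`re_laplace_nonneg_of_posDef`):

take `x_j = jδ`, `z_j = e^{-zjδ}` (`re_geom_generating_nonneg` of the Toeplitz file gives
`0 ≤ Re (2 Σ_m a(mδ) e^{-zmδ} - a(0))`), multiply by `δ/2` and let `δ = 1/(N+1) → 0`: the Riemann sums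
`δ Σ_m f(mδ)` of `f(x) = a(x) e^{-zx}` converge to `∫₀^∞ f` (`tendsto_riemannSum_Ioi`, dominated convergence for
the step functions `f(δ⌊x/δ⌋)` under the majorant `C e^{ε} e^{-εx}`). This is the half-plane (Laplace) form of
Herglotz–Bochner positivity, proved here without the spectral measure.
-/

noncomputable section

-- `Summit.RiemannHypothesis.RiemannHypothesis.…` repeats a namespace component by design (D-0017 layout).
set_option linter.dupNamespace false

open Complex Filter Topology Finset MeasureTheory Set
open scoped ComplexConjugate BigOperators

namespace Summit.RiemannHypothesis.RiemannHypothesis.Theorems.SignConeExactConeRigidity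

/-! ## Riemann sums on `(0, ∞)` for exponentially dominated continuous functions -/

/-- `[0, ∞)` is the disjoint union of the cells `[mδ, (m+1)δ)`, `m ∈ ℕ` (`δ > 0`). -/
theorem iUnion_Ico_mul_eq_Ici {δ : ℝ} (hδ : 0 < δ) :
    (⋃ m : ℕ, Ico ((m : ℝ) * δ) (((m : ℝ) + 1) * δ)) = Ici (0 : ℝ) := by
  ext x
  simp only [mem_iUnion, Set.mem_Ico, Set.mem_Ici]
  constructor
  · rintro ⟨m, hm, -⟩
    exact le_trans (by positivity) hm
  · intro hx
    refine ⟨⌊x / δ⌋₊, ?_, ?_⟩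
    · have := Nat.floor_le (div_nonneg hx hδ.le)
      rwa [le_div_iff₀ hδ] at this
    · have := Nat.lt_floor_add_one (x / δ)
      rwa [div_lt_iff₀ hδ] at this

/-- On the cell `[mδ, (m+1)δ)` the floor `⌊x/δ⌋₊` equals `m`. -/
theorem nat_floor_div_eq_of_mem_Ico {δ : ℝ} (hδ : 0 < δ) {m : ℕ} {x : ℝ}
    (hx : x ∈ Ico ((m : ℝ) * δ) (((m : ℝ) + 1) * δ)) : ⌊x / δ⌋₊ = m := by
  obtain ⟨h1, h2⟩ := hx
  have hx0 : 0 ≤ x / δ := div_nonneg (le_trans (by positivity) h1) hδ.le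
  rw [Nat.floor_eq_iff hx0, le_div_iff₀ hδ, div_lt_iff₀ hδ]
  exact ⟨h1, h2⟩

/-- The integral over `(0, ∞)` of the step function `x ↦ f(δ ⌊x/δ⌋₊)` is the Riemann sum `δ Σ_m f(mδ)`
(for `f` with `‖f(x)‖ ≤ C e^{-εx}` on `x ≥ 0`, which makes everything absolutely convergent). -/
theorem integral_step_eq_riemannSum {f : ℝ → ℂ} (hf : Continuous f) {C ε : ℝ} (hε : 0 < ε)
    (hC : ∀ x, 0 ≤ x → ‖f x‖ ≤ C * Real.exp (-(ε * x))) {δ : ℝ} (hδ : 0 < δ) (hδ1 : δ ≤ 1) :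
    ∫ x in Ioi (0 : ℝ), f (δ * ⌊x / δ⌋₊) = δ * ∑' m : ℕ, f ((m : ℝ) * δ) := by
  have hC0 : 0 ≤ C := by
    have := hC 0 le_rfl
    rw [mul_zero, neg_zero, Real.exp_zero, mul_one] at this
    exact (norm_nonneg _).trans this
  set F : ℝ → ℂ := fun x => f (δ * ⌊x / δ⌋₊) with hF
  have hFm : Measurable F :=
    hf.measurable.comp (measurable_const.mul (Nat.measurable_floor.comp (measurable_id.div_const δ) |>
      (measurable_from_nat.comp ·)))
  -- domination `‖F x‖ ≤ C e^{ε} e^{-εx}` on `x > 0`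
  have hdom : ∀ x : ℝ, 0 < x → ‖F x‖ ≤ C * Real.exp ε * Real.exp (-(ε * x)) := by
    intro x hx
    have hy0 : 0 ≤ δ * ⌊x / δ⌋₊ := by positivity
    have hy1 : x - δ ≤ δ * ⌊x / δ⌋₊ := by
      have := (Nat.lt_floor_add_one (x / δ)).le
      rw [div_le_iff₀ hδ] at this
      nlinarith
    refine (hC _ hy0).trans ?_
    rw [mul_assoc, ← Real.exp_add]
    refine mul_le_mul_of_nonneg_left (Real.exp_le_exp.2 ?_) hC0
    nlinarith
  have hFi : IntegrableOn F (Ioi 0) := by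
    have hi := ((exp_neg_integrableOn_Ioi 0 hε).const_mul (C * Real.exp ε))
    refine Integrable.mono' hi hFm.aestronglyMeasurable ?_
    refine (ae_restrict_iff' measurableSet_Ioi).2 (Eventually.of_forall fun x hx => ?_)
    have := hdom x hx
    simpa [neg_mul] using this
  -- pass to `[0, ∞) = ⋃ cells`
  rw [setIntegral_congr_set Ioi_ae_eq_Ici, ← iUnion_Ico_mul_eq_Ici hδ]
  have hFi' : IntegrableOn F (⋃ m : ℕ, Ico ((m : ℝ) * δ) (((m : ℝ) + 1) * δ)) := by
    rw [iUnion_Ico_mul_eq_Ici hδ]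
    exact hFi.congr_set_ae Ioi_ae_eq_Ici.symm
  have hdisj : Pairwise (Function.onFun Disjoint fun m : ℕ => Ico ((m : ℝ) * δ) (((m : ℝ) + 1) * δ)) := by
    intro m m' hne
    rcases lt_or_gt_of_ne hne with h | h
    · refine Set.disjoint_left.2 fun x hx hx' => ?_
      have h1 : ((m : ℝ) + 1) * δ ≤ (m' : ℝ) * δ :=
        mul_le_mul_of_nonneg_right (by exact_mod_cast h) hδ.le
      exact absurd (lt_of_lt_of_le hx.2 (h1.trans hx'.1)) (lt_irrefl x)
    · refine Set.disjoint_left.2 fun x hx hx' => ?_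
      have h1 : ((m' : ℝ) + 1) * δ ≤ (m : ℝ) * δ :=
        mul_le_mul_of_nonneg_right (by exact_mod_cast h) hδ.le
      exact absurd (lt_of_lt_of_le hx'.2 (h1.trans hx.1)) (lt_irrefl x)
  rw [integral_iUnion (fun m => measurableSet_Ico) hdisj hFi', ← tsum_mul_left]
  refine tsum_congr fun m => ?_
  have hcell : ∀ x ∈ Ico ((m : ℝ) * δ) (((m : ℝ) + 1) * δ), F x = f ((m : ℝ) * δ) := by
    intro x hx
    simp only [hF, nat_floor_div_eq_of_mem_Ico hδ hx]
    ring_nf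
  rw [setIntegral_congr_fun measurableSet_Ico hcell, setIntegral_const, Real.volume_real_Ico_of_le
    (by nlinarith)]
  rw [Complex.real_smul]
  congr 1
  push_cast
  ring

/-- **Riemann sums on `(0, ∞)`.** For `f : ℝ → ℂ` continuous with `‖f(x)‖ ≤ C e^{-εx}` on `x ≥ 0`
(`ε > 0`), the Riemann sums `δ_N Σ_m f(m δ_N)`, `δ_N = 1/(N+1)`, converge to `∫₀^∞ f` (dominated
convergence for the step functions `f(δ⌊x/δ⌋₊)`, majorant `C e^{ε} e^{-εx}`). -/
theorem tendsto_riemannSum_Ioi {f : ℝ → ℂ} (hf : Continuous f) {C ε : ℝ} (hε : 0 < ε)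
    (hC : ∀ x, 0 ≤ x → ‖f x‖ ≤ C * Real.exp (-(ε * x))) :
    Tendsto (fun N : ℕ => (1 / ((N : ℝ) + 1) : ℝ) * ∑' m : ℕ, f ((m : ℝ) * (1 / ((N : ℝ) + 1))))
      atTop (𝓝 (∫ x in Ioi (0 : ℝ), f x)) := by
  have hC0 : 0 ≤ C := by
    have := hC 0 le_rfl
    rw [mul_zero, neg_zero, Real.exp_zero, mul_one] at this
    exact (norm_nonneg _).trans this
  set δ : ℕ → ℝ := fun N => 1 / ((N : ℝ) + 1) with hδ
  have hδp : ∀ N, 0 < δ N := fun N => by positivity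
  have hδ1 : ∀ N, δ N ≤ 1 := fun N => by
    rw [hδ, div_le_one (by positivity)]
    linarith [(Nat.cast_nonneg N : (0 : ℝ) ≤ N)]
  have hδ0 : Tendsto δ atTop (𝓝 0) := tendsto_one_div_add_atTop_nhds_zero_nat
  -- rewrite the Riemann sums as integrals of step functions
  have hstep : ∀ N, ((δ N : ℝ) : ℂ) * ∑' m : ℕ, f ((m : ℝ) * δ N) =
      ∫ x in Ioi (0 : ℝ), f (δ N * ⌊x / δ N⌋₊) := fun N =>
    (integral_step_eq_riemannSum hf hε hC (hδp N) (hδ1 N)).symm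
  have e : (fun N : ℕ => (((1 / ((N : ℝ) + 1) : ℝ)) : ℂ) * ∑' m : ℕ, f ((m : ℝ) * (1 / ((N : ℝ) + 1)))) =
      fun N => ∫ x in Ioi (0 : ℝ), f (δ N * ⌊x / δ N⌋₊) := funext fun N => hstep N
  rw [e]
  -- dominated convergence
  refine tendsto_integral_of_dominated_convergence (fun x => C * Real.exp ε * Real.exp (-(ε * x)))
    (fun N => ?_) ?_ (fun N => ?_) ?_
  · exact (hf.measurable.comp (measurable_const.mul (Nat.measurable_floor.comp
      (measurable_id.div_const (δ N)) |> (measurable_from_nat.comp ·)))).aestronglyMeasurable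
  · have hi := ((exp_neg_integrableOn_Ioi 0 hε).const_mul (C * Real.exp ε))
    simpa [neg_mul] using hi
  · refine (ae_restrict_iff' measurableSet_Ioi).2 (Eventually.of_forall fun x hx => ?_)
    have hx' : 0 < x := hx
    have hy0 : 0 ≤ δ N * ⌊x / δ N⌋₊ := by positivity
    have hy1 : x - δ N ≤ δ N * ⌊x / δ N⌋₊ := by
      have := (Nat.lt_floor_add_one (x / δ N)).le
      rw [div_le_iff₀ (hδp N)] at this
      nlinarith
    refine (hC _ hy0).trans ?_
    rw [mul_assoc, ← Real.exp_add]
    refine mul_le_mul_of_nonneg_left (Real.exp_le_exp.2 ?_) hC0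
    nlinarith [hδ1 N]
  · refine (ae_restrict_iff' measurableSet_Ioi).2 (Eventually.of_forall fun x hx => ?_)
    have hx' : 0 < x := hx
    have harg : Tendsto (fun N => δ N * ⌊x / δ N⌋₊) atTop (𝓝 x) := by
      refine tendsto_of_tendsto_of_tendsto_of_le_of_le (g := fun N => x - δ N) (h := fun _ => x) ?_
        tendsto_const_nhds (fun N => ?_) (fun N => ?_)
      · have := (tendsto_const_nhds (x := x)).sub hδ0
        rwa [sub_zero] at this
      · have := (Nat.lt_floor_add_one (x / δ N)).le
        rw [div_le_iff₀ (hδp N)] at this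
        show x - δ N ≤ δ N * ⌊x / δ N⌋₊
        nlinarith
      · have := Nat.floor_le (div_nonneg hx'.le (hδp N).le)
        rw [le_div_iff₀ (hδp N)] at this
        show δ N * ⌊x / δ N⌋₊ ≤ x
        linarith
    exact (hf.tendsto x).comp harg

/-! ## Positivity of the Laplace transform -/

/-- **The Laplace transform of a bounded continuous positive-definite function has nonnegative real part
on the right half-plane.** Let `a : ℝ → ℂ` be continuous, bounded, hermitian (`a(-x) = conj a(x)`) and
positive-definite in the elementary sense (`0 ≤ Re Σ_{j,k} z_j conj(z_k) a(x_j - x_k)` for all finite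
families). Then `0 ≤ Re ∫₀^∞ a(x) e^{-zx} dx` for `Re z > 0`. (Half-plane form of Herglotz–Bochner
positivity: `x_j = jδ`, `z_j = e^{-zjδ}` and `re_geom_generating_nonneg` give
`0 ≤ Re (2 Σ_m a(mδ) e^{-zmδ} - a(0))`; multiply by `δ/2` and let `δ → 0` by `tendsto_riemannSum_Ioi`.) -/
theorem re_laplace_nonneg_of_posDef {a : ℝ → ℂ} (hcont : Continuous a) {B : ℝ} (hB : ∀ x, ‖a x‖ ≤ B)
    (hsymm : ∀ x, a (-x) = conj (a x))
    (hpd : ∀ (N : ℕ) (z : ℕ → ℂ) (x : ℕ → ℝ),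
      0 ≤ (∑ j ∈ range N, ∑ k ∈ range N, z j * conj (z k) * a (x j - x k)).re)
    {z : ℂ} (hz : 0 < z.re) :
    0 ≤ (∫ x in Ioi (0 : ℝ), a x * cexp (-(z * x))).re := by
  -- Step 1: for every `δ > 0`, `0 ≤ Re (2 Σ_m a(mδ) e^{-zmδ} - a(0))`
  have hgen : ∀ δ : ℝ, 0 < δ →
      0 ≤ (2 * ∑' m : ℕ, a ((m : ℝ) * δ) * cexp (-(z * ((m : ℝ) * δ))) - a 0).re := by
    intro δ hδ
    set w : ℂ := cexp (-(z * δ)) with hw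
    have hwn : ‖w‖ < 1 := by
      rw [hw, Complex.norm_exp]
      refine Real.exp_lt_one_iff.2 ?_
      simp only [neg_re, mul_re, ofReal_re, ofReal_im, mul_zero, sub_zero, Left.neg_neg_iff]
      exact mul_pos hz hδ
    have hwpow : ∀ m : ℕ, w ^ m = cexp (-(z * ((m : ℝ) * δ))) := by
      intro m
      rw [hw, ← Complex.exp_nat_mul]
      congr 1
      push_cast
      ring
    set u : ℕ → ℂ := fun m => a ((m : ℝ) * δ) with hu
    have hu0 : u 0 = a 0 := by simp [hu]
    have key := re_geom_generating_nonneg (u := u) (fun m => hB _) hwn (fun N => by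
      have h := hpd N (fun j => w ^ j) (fun j => (j : ℝ) * δ)
      have e : ∑ j ∈ range N, ∑ k ∈ range N, w ^ j * conj (w ^ k) * a ((j : ℝ) * δ - (k : ℝ) * δ) =
          ∑ j ∈ range N, ∑ k ∈ range N,
            w ^ j * conj w ^ k * (if k ≤ j then u (j - k) else conj (u (k - j))) := by
        refine sum_congr rfl fun j _ => sum_congr rfl fun k _ => ?_
        rw [map_pow]
        congr 1
        split_ifs with hkj
        · simp only [hu]
          rw [Nat.cast_sub hkj, sub_mul]
        · simp only [hu]
          rw [← hsymm, Nat.cast_sub (le_of_not_ge hkj)]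
          congr 1
          ring
      rwa [e] at h)
    simp only [hu0] at key
    have e2 : ∑' m : ℕ, u m * w ^ m = ∑' m : ℕ, a ((m : ℝ) * δ) * cexp (-(z * ((m : ℝ) * δ))) :=
      tsum_congr fun m => by rw [hwpow]
    rwa [e2] at key
  -- Step 2: Riemann sums of `f(x) = a(x) e^{-zx}`
  set f : ℝ → ℂ := fun x => a x * cexp (-(z * x)) with hf
  have hfc : Continuous f := by simp only [hf]; fun_prop
  have hfb : ∀ x, 0 ≤ x → ‖f x‖ ≤ B * Real.exp (-(z.re * x)) := by
    intro x _
    simp only [hf, norm_mul, Complex.norm_exp, neg_re, mul_re, ofReal_re, ofReal_im, mul_zero, sub_zero]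
    exact mul_le_mul_of_nonneg_right (hB x) (Real.exp_pos _).le
  have hR := tendsto_riemannSum_Ioi hfc hz hfb
  set δ : ℕ → ℝ := fun N => 1 / ((N : ℝ) + 1) with hδ
  have hδp : ∀ N, 0 < δ N := fun N => by positivity
  have hδ0 : Tendsto δ atTop (𝓝 0) := tendsto_one_div_add_atTop_nhds_zero_nat
  -- `Re (δ_N Σ f(mδ_N)) - (δ_N/2) Re a(0) ≥ 0` for all `N`, and its limit is `Re ∫ f`
  have hseq : ∀ N : ℕ, 0 ≤ (((δ N : ℝ) : ℂ) * ∑' m : ℕ, f ((m : ℝ) * δ N)).re - δ N / 2 * (a 0).re := by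
    intro N
    have h := hgen (δ N) (hδp N)
    have e : ((δ N : ℝ) : ℂ) * ∑' m : ℕ, f ((m : ℝ) * δ N) =
        ((δ N / 2 : ℝ) : ℂ) * (2 * ∑' m : ℕ, a ((m : ℝ) * δ N) * cexp (-(z * ((m : ℝ) * δ N))) - a 0) +
          ((δ N / 2 : ℝ) : ℂ) * a 0 := by
      simp only [hf]
      push_cast
      ring
    rw [e, Complex.add_re, Complex.re_ofReal_mul, Complex.re_ofReal_mul]
    nlinarith [hδp N]
  have hlim : Tendsto (fun N : ℕ => (((δ N : ℝ) : ℂ) * ∑' m : ℕ, f ((m : ℝ) * δ N)).re - δ N / 2 * (a 0).re)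
      atTop (𝓝 ((∫ x in Ioi (0 : ℝ), f x).re - 0 / 2 * (a 0).re)) :=
    ((Complex.continuous_re.tendsto _).comp hR).sub ((hδ0.div_const 2).mul_const _)
  rw [zero_div, zero_mul, sub_zero] at hlim
  exact ge_of_tendsto' hlim hseq

end Summit.RiemannHypothesis.RiemannHypothesis.Theorems.SignConeExactConeRigidity
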